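/-
Copyright (c) 2026 the pub-hodgecm-mathlib formalisation cell (harness21).  Prover seat hodgecm-mathlib-K2E3-p23 (g7), HCML Track B «K2-LIT»,
h413 = `stmt-HodgeConjecture-24833`, line `K2_E3_EllipticInputs`, unit U12 «Characters», PART «SC» leaf (SC-an)₂ ∕ socket (M5h)₂
`sig_K2E3SupercuspidalTruncatedCharAnalyticTwoOfEllWeight`, road «FC₂» (L4 EMIT #3 2026-09-04T15:02:09Z «TOP = THE (M5h)₂ PAYER»), FILE 2 of 2: THE SOCKET SHAPE.  2026-09-04.
-/
import Summits.HodgeConjecture.HodgeConjecture.Theorems.K2E3SupercuspidalTruncatedCharAnalyticOfEllWeightPlaceTwo   -- FILE 1 (this seat): `sigSCan_datum_of_ellWeightPlace_of_fieldModel_two`; brings ★ `localNonsplitEquiv`, ★ `antidiagOne_eq_over`, ★ `StdForm.over_map`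
import HarnessLib

/-!
# h413 ∕ Track B «K2-LIT», unit U12, PART «SC» leaf (SC-an)₂, road «FC₂» — THE (M5h)₂ PAYER (FILE 2 of 2): «ELL-WEIGHT₂ AT THE PLACE» ⇒ (SC-an)₂
# `sig_K2E3SupercuspidalTruncatedCharAnalyticTwo` (PART «SC» ED. 2 :98 VERBATIM), MODULO THE FIVE N = 2 CHAIN LETTERS (LIM₂) (SHELL₂) (TOK₂) (TORΩ₂) (DEPTH₂)
# (Harish-Chandra 1970, Part VII §3 Theorem 16 for `U(1,1)`; the `Fin 2` twin of ★ (M5h‴) §2 with NO anisotropic branch)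

Cell `pub/hodgecm-mathlib`, crux H413 = `stmt-HodgeConjecture-24833`, route of record `HCCMUnconditional`; chair K2-lead (g2), L4 LINE-LEAD ∕ dealer K2E3-plan (g4), architect
K2E3-p25 (g3), (M5h)₂ chain desk K2E3-p27 (g0), map K2E3-p33 (g0).  THEOREMS ONLY (no `def`, no `instance`, no `notation`, no named-fact hypothesis, no `sorry`); lane
`--supports stmt-HodgeConjecture-24833 --as helper`, count-neutral.

For `Φ₂ = Matrix.of (i + j + 1 = 2)` (ISOTROPIC at every place — K2E3-p33 (g0) map 2026-09-04T15:03:33Z: no (f2) dispatch, no `…HC14Ell*` twin) the field model is ★ `localNonsplitEquiv`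
rewritten along `placeForm Φ₂ w = (StdForm.antidiagonal 2).over L_w` (★ `antidiagOne_eq_over`, ★ `StdForm.over_map`; the ★ Phi3Model :260 idiom), at any `w ∣ v` (`Nonempty (PlacesOver L v)`),
and FILE 1 concludes.  The statement after the five letters is EXACTLY the socket (M5h)₂ `sig_K2E3SupercuspidalTruncatedCharAnalyticTwoOfEllWeight` (= binder `hM5h₂` of ★
`K2E3SupercuspidalTruncatedCharAnalyticTwoOfLetters.sigSCanTwo_of_letters`; text `K2/K2E3-p23/g7/sockets_SC_ED3.txt` block 3), so the PART «SC» tie is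
`sig_K2E3SupercuspidalTruncatedCharAnalyticTwoOfEllWeight := K2E3SupercuspidalTruncatedCharAnalyticTwoOfEllWeight.sigSCanTwo_of_ellWeightPlace_two ‹LIM₂› ‹SHELL₂› ‹TOK₂› ‹TORΩ₂› ‹DEPTH₂›`.
* **`sigSCanTwo_of_ellWeightPlace_two (hLIM hSHELL hTOK hTORΩ hDEPTH) : ‹hEW₂ ∀-closed› → ‹(SC-an)₂ :98 VERBATIM›`**.

HONEST LABEL.  HC_CM is proved only modulo the 7 printed citations (2 remaining named inputs: hLiu418 = `stmt-HodgeConjecture-24832`, h413 = `stmt-HodgeConjecture-24833`)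
until rung 0 closes; count-neutral; (M5h)₂ becomes REL over EXACTLY {LIM₂, SHELL₂, TOK₂, TORΩ₂, DEPTH₂} when tied — NOT ★; (SC-an)₂ then REL over {COLL₂} ∪ those.

## References
* [HarishChandra1970] Harish-Chandra (notes by G. van Dijk), *Harmonic Analysis on Reductive p-adic Groups*, LNM 162 (1970), Part VII §3 Theorem 16 p. 67, pp. 70–73.
* [HarishChandra1999] Harish-Chandra (notes by S. DeBacker, P. J. Sally Jr.), *Admissible Invariant Distributions on Reductive p-adic Groups*, AMS ULS 16 (1999), Thm. 16.1 p. 77.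
* [Rogawski1990] J. D. Rogawski, *Automorphic Representations of Unitary Groups in Three Variables*, Ann. of Math. Stud. 123 (1990), §1.9 p. 8, §12.2 p. 173.
-/

set_option autoImplicit false
-- the mandated namespace repeats the single-problem summit's segment (`HodgeConjecture.HodgeConjecture`)
set_option linter.dupNamespace false

noncomputable section

open MeasureTheory Measure Set Filter Topology NumberField IsDedekindDomain
open scoped NNReal ENNReal Pointwise Matrix MatrixGroups WithZero
open ValuativeRel
open Literature.NumberTheory.Automorphic Literature.NumberTheory.Automorphic.UnitaryGroup Literature.NumberTheory.Automorphic.HermitianLattice Literature.NumberTheory.Rogawski1990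
open Literature.NumberTheory.GaloisRepresentations Literature.NumberTheory.GaloisRepresentations.IsNonarchimedeanLocalField

namespace Summit.HodgeConjecture.HodgeConjecture.Cruxes.H413.K2E3SupercuspidalTruncatedCharAnalyticTwoOfEllWeight

/-! ## The (M5h)₂ socket shape: «ELL-WEIGHT₂ at the place» ⇒ (SC-an)₂, modulo the five letters -/
set_option maxHeartbeats 3200000 in -- long statement (six ∀-closed letters + the (SC-an)₂ socket text)
open scoped Classical in
/-- **THE (M5h)₂ PAYER — «ELL-WEIGHT₂ AT THE PLACE» ⇒ (SC-an)₂ `sig_K2E3SupercuspidalTruncatedCharAnalyticTwo` (PART «SC» ED. 2 :98 VERBATIM), MODULO (LIM₂) (SHELL₂) (TOK₂) (TORΩ₂)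
(DEPTH₂).**  For `Φ₂ = Matrix.of (i + j + 1 = 2)` (isotropic at every place) the field model `e` is ★ `localNonsplitEquiv` along `placeForm Φ₂ w = (StdForm.antidiagonal 2).over L_w`,
and §1 applies at any `w ∣ v` (there is one: `Nonempty (PlacesOver L v)`).  The statement after the five letters is EXACTLY the socket (M5h)₂
`sig_K2E3SupercuspidalTruncatedCharAnalyticTwoOfEllWeight` (= binder `hM5h₂` of ★ `K2E3SupercuspidalTruncatedCharAnalyticTwoOfLetters.sigSCanTwo_of_letters`), so the tie is
`:= sigSCanTwo_of_ellWeightPlace_two ‹LIM₂› ‹SHELL₂› ‹TOK₂› ‹TORΩ₂› ‹DEPTH₂›`. [cite: HarishChandra1970, Part VII §3 Theorem 16 p. 67, pp. 70–73] [cite: HarishChandra1999, Thm. 16.1 p. 77]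
[cite: Rogawski1990, §12.2 p. 173] -/
theorem sigSCanTwo_of_ellWeightPlace_two
    (hLIM : ∀ (L : Type) [Field L] [NumberField L] [IsCMField L] {v : HeightOneSpectrum (𝓞 ↥(maximalRealSubfield L))} (w : PlacesOver L v) (hw : IsCMField.complexConj L • w.1 = w.1)
          [MeasurableSpace ((UnitaryGroup.cmDatum L 2 (Matrix.of fun i j : Fin 2 => if i.val + j.val + 1 = 2 then (1 : L) else 0)).Local v)] [BorelSpace ((UnitaryGroup.cmDatum L 2 (Matrix.of fun i j : Fin 2 => if i.val + j.val + 1 = 2 then (1 : L) else 0)).Local v)]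
          (μ : Measure ((UnitaryGroup.cmDatum L 2 (Matrix.of fun i j : Fin 2 => if i.val + j.val + 1 = 2 then (1 : L) else 0)).Local v)) [μ.IsHaarMeasure]
          [MeasurableSpace ↥(unitaryGroupOfForm (galAdicCompletionMap (L := L) (IsCMField.complexConj L) hw) ((StdForm.antidiagonal 2).over (w.1.adicCompletion L)))]
          [BorelSpace ↥(unitaryGroupOfForm (galAdicCompletionMap (L := L) (IsCMField.complexConj L) hw) ((StdForm.antidiagonal 2).over (w.1.adicCompletion L)))]
          (e : (UnitaryGroup.cmDatum L 2 (Matrix.of fun i j : Fin 2 => if i.val + j.val + 1 = 2 then (1 : L) else 0)).Local v ≃ₜ*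
            ↥(unitaryGroupOfForm (galAdicCompletionMap (L := L) (IsCMField.complexConj L) hw) ((StdForm.antidiagonal 2).over (w.1.adicCompletion L))))
          (ΩM : CompactExhaustion ↥(unitaryGroupOfForm (galAdicCompletionMap (L := L) (IsCMField.complexConj L) hw) ((StdForm.antidiagonal 2).over (w.1.adicCompletion L))))
          {ϖ : w.1.adicCompletion L} (hϖ : Valued.v ϖ = WithZero.exp (-1 : ℤ))
          (hmem : ∀ (m : ℕ) (g : ↥(unitaryGroupOfForm (galAdicCompletionMap (L := L) (IsCMField.complexConj L) hw) ((StdForm.antidiagonal 2).over (w.1.adicCompletion L)))), g ∈ ΩM m ↔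
            (∀ i j, Valued.v (ϖ ^ m * ((g : GL (Fin 2) (w.1.adicCompletion L)) : Matrix (Fin 2) (Fin 2) (w.1.adicCompletion L)) i j) ≤ 1) ∧
              ∀ i j, Valued.v (ϖ ^ m * (((g : GL (Fin 2) (w.1.adicCompletion L))⁻¹ : GL (Fin 2) (w.1.adicCompletion L)) : Matrix (Fin 2) (Fin 2) (w.1.adicCompletion L)) i j) ≤ 1)
          (hinv : ∀ (m : ℕ) (g : ↥(unitaryGroupOfForm (galAdicCompletionMap (L := L) (IsCMField.complexConj L) hw) ((StdForm.antidiagonal 2).over (w.1.adicCompletion L)))), g ∈ ΩM m → g⁻¹ ∈ ΩM m)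
          (hmul : ∀ (a b : ℕ) (g h : ↥(unitaryGroupOfForm (galAdicCompletionMap (L := L) (IsCMField.complexConj L) hw) ((StdForm.antidiagonal 2).over (w.1.adicCompletion L)))),
            g ∈ ΩM a → h ∈ ΩM b → g * h ∈ ΩM (a + b))
          {V : Type} [AddCommGroup V] [Module ℂ V] (ρ : Representation ℂ ((UnitaryGroup.cmDatum L 2 (Matrix.of fun i j : Fin 2 => if i.val + j.val + 1 = 2 then (1 : L) else 0)).Local v) V) (hsm : ρ.IsSmooth) (hsc : ρ.IsSupercuspidal)
          (B : V →ₗ⋆[ℂ] V →ₗ[ℂ] ℂ) (hBinv : ∀ (g : (UnitaryGroup.cmDatum L 2 (Matrix.of fun i j : Fin 2 => if i.val + j.val + 1 = 2 then (1 : L) else 0)).Local v) (x y : V), B (ρ g x) (ρ g y) = B x y) (u u' : V),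
          ∃ (Ω : CompactExhaustion ((UnitaryGroup.cmDatum L 2 (Matrix.of fun i j : Fin 2 => if i.val + j.val + 1 = 2 then (1 : L) else 0)).Local v)) (R : (UnitaryGroup.cmDatum L 2 (Matrix.of fun i j : Fin 2 => if i.val + j.val + 1 = 2 then (1 : L) else 0)).Local v → ℕ) (mθ : ℕ)
            (F : (UnitaryGroup.cmDatum L 2 (Matrix.of fun i j : Fin 2 => if i.val + j.val + 1 = 2 then (1 : L) else 0)).Local v → ℂ) (Bset : (UnitaryGroup.cmDatum L 2 (Matrix.of fun i j : Fin 2 => if i.val + j.val + 1 = 2 then (1 : L) else 0)).Local v → Set ((UnitaryGroup.cmDatum L 2 (Matrix.of fun i j : Fin 2 => if i.val + j.val + 1 = 2 then (1 : L) else 0)).Local v)),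
            (∀ n : ℕ, (Ω n : Set ((UnitaryGroup.cmDatum L 2 (Matrix.of fun i j : Fin 2 => if i.val + j.val + 1 = 2 then (1 : L) else 0)).Local v)) = e ⁻¹' (ΩM n)) ∧
            (∀ g, Bset g = e ⁻¹' (ΩM (R g))) ∧ (∀ g, IsCompact (Bset g)) ∧ (∀ᵐ g ∂μ, ¬ (IsRegularElt (g.val : GL (Fin 2) (UnitaryGroup.LocalRing L v)) ∧
                IsCompact ((Subgroup.centralizer ({g} : Set ((UnitaryGroup.cmDatum L 2 (Matrix.of fun i j : Fin 2 => if i.val + j.val + 1 = 2 then (1 : L) else 0)).Local v))) : Set ((UnitaryGroup.cmDatum L 2 (Matrix.of fun i j : Fin 2 => if i.val + j.val + 1 = 2 then (1 : L) else 0)).Local v))) →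
              Tendsto (fun n => ∫ x in Ω n, B u' (ρ (x * g * x⁻¹) u) ∂μ) atTop (𝓝 (F g))) ∧ (∀ n : ℕ, ∀ᵐ g ∂μ, ¬ (IsRegularElt (g.val : GL (Fin 2) (UnitaryGroup.LocalRing L v)) ∧
                IsCompact ((Subgroup.centralizer ({g} : Set ((UnitaryGroup.cmDatum L 2 (Matrix.of fun i j : Fin 2 => if i.val + j.val + 1 = 2 then (1 : L) else 0)).Local v))) : Set ((UnitaryGroup.cmDatum L 2 (Matrix.of fun i j : Fin 2 => if i.val + j.val + 1 = 2 then (1 : L) else 0)).Local v))) →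
              ∫ x in Ω n, B u' (ρ (x * g * x⁻¹) u) ∂μ = ∫ x in Ω n ∩ Bset g, B u' (ρ (x * g * x⁻¹) u) ∂μ) ∧
            (∀ m' : ↥(unitaryGroupOfForm (galAdicCompletionMap (L := L) (IsCMField.complexConj L) hw) ((StdForm.antidiagonal 2).over (w.1.adicCompletion L))),
              B u' (ρ (e.symm m') u) ≠ 0 → m' ∈ ΩM mθ) ∧
            (∀ g : (UnitaryGroup.cmDatum L 2 (Matrix.of fun i j : Fin 2 => if i.val + j.val + 1 = 2 then (1 : L) else 0)).Local v, IsRegularElt ((e g : ↥(unitaryGroupOfForm (galAdicCompletionMap (L := L) (IsCMField.complexConj L) hw)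
                ((StdForm.antidiagonal 2).over (w.1.adicCompletion L)))) : GL (Fin 2) (w.1.adicCompletion L)) →
              ¬ IsCompact ((Subgroup.centralizer ({g} : Set ((UnitaryGroup.cmDatum L 2 (Matrix.of fun i j : Fin 2 => if i.val + j.val + 1 = 2 then (1 : L) else 0)).Local v))) : Set ((UnitaryGroup.cmDatum L 2 (Matrix.of fun i j : Fin 2 => if i.val + j.val + 1 = 2 then (1 : L) else 0)).Local v)) →
              ∃ (t y₀ : ↥(unitaryGroupOfForm (galAdicCompletionMap (L := L) (IsCMField.complexConj L) hw) ((StdForm.antidiagonal 2).over (w.1.adicCompletion L))))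
                (d : Fin 2 → (w.1.adicCompletion L)ˣ) (lam mg : ℕ),
                glDiagonal 2 (w.1.adicCompletion L) d = (t : GL (Fin 2) (w.1.adicCompletion L)) ∧ IsRegularElt (t : GL (Fin 2) (w.1.adicCompletion L)) ∧
                (∀ i k : Fin 2, i ≠ k → Valued.v (ϖ ^ lam) ≤ Valued.v ((d i : w.1.adicCompletion L) - d k)) ∧
                (∀ lam' : ℕ, (∀ i k : Fin 2, i ≠ k → Valued.v (ϖ ^ lam') ≤ Valued.v ((d i : w.1.adicCompletion L) - d k)) → lam ≤ lam') ∧ e g ∈ ΩM mg ∧ (∀ m' : ℕ, e g ∈ ΩM m' → mg ≤ m') ∧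
                y₀ ∈ ΩM (2 * mg + 2 * lam) ∧ e g = y₀ * t * y₀⁻¹ ∧ R g = 5 * (2 * mθ + 2 * lam) + 3 * (2 * mg + 2 * lam) + 1) ∧
            (∀ᵐ g ∂μ, IsRegularElt ((e g : ↥(unitaryGroupOfForm (galAdicCompletionMap (L := L) (IsCMField.complexConj L) hw)
                ((StdForm.antidiagonal 2).over (w.1.adicCompletion L)))) : GL (Fin 2) (w.1.adicCompletion L))) ∧
            (∀ W_M : ↥(unitaryGroupOfForm (galAdicCompletionMap (L := L) (IsCMField.complexConj L) hw) ((StdForm.antidiagonal 2).over (w.1.adicCompletion L))) → ℝ,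
              (∀ᵐ g ∂μ, ¬ (IsRegularElt (g.val : GL (Fin 2) (UnitaryGroup.LocalRing L v)) ∧
                  IsCompact ((Subgroup.centralizer ({g} : Set ((UnitaryGroup.cmDatum L 2 (Matrix.of fun i j : Fin 2 => if i.val + j.val + 1 = 2 then (1 : L) else 0)).Local v))) : Set ((UnitaryGroup.cmDatum L 2 (Matrix.of fun i j : Fin 2 => if i.val + j.val + 1 = 2 then (1 : L) else 0)).Local v))) →
                ∫ x' in ΩM (R g), ‖B u' (ρ (e.symm (x' * e g * x'⁻¹)) u)‖ ∂(μ.map e) ≤ W_M (e g)) → ∀ᵐ g ∂μ, ¬ (IsRegularElt (g.val : GL (Fin 2) (UnitaryGroup.LocalRing L v)) ∧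
                  IsCompact ((Subgroup.centralizer ({g} : Set ((UnitaryGroup.cmDatum L 2 (Matrix.of fun i j : Fin 2 => if i.val + j.val + 1 = 2 then (1 : L) else 0)).Local v))) : Set ((UnitaryGroup.cmDatum L 2 (Matrix.of fun i j : Fin 2 => if i.val + j.val + 1 = 2 then (1 : L) else 0)).Local v))) →
                ∫ x in Bset g, ‖B u' (ρ (x * g * x⁻¹) u)‖ ∂μ ≤ W_M (e g)) ∧
            (∀ W_M : ↥(unitaryGroupOfForm (galAdicCompletionMap (L := L) (IsCMField.complexConj L) hw) ((StdForm.antidiagonal 2).over (w.1.adicCompletion L))) → ℝ,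
              (∀ᵐ g ∂μ, (IsRegularElt (g.val : GL (Fin 2) (UnitaryGroup.LocalRing L v)) ∧
                  IsCompact ((Subgroup.centralizer ({g} : Set ((UnitaryGroup.cmDatum L 2 (Matrix.of fun i j : Fin 2 => if i.val + j.val + 1 = 2 then (1 : L) else 0)).Local v))) : Set ((UnitaryGroup.cmDatum L 2 (Matrix.of fun i j : Fin 2 => if i.val + j.val + 1 = 2 then (1 : L) else 0)).Local v))) →
                ∫ x', ‖B u' (ρ (e.symm (x' * e g * x'⁻¹)) u)‖ ∂(μ.map e) ≤ W_M (e g)) → ∀ᵐ g ∂μ, (IsRegularElt (g.val : GL (Fin 2) (UnitaryGroup.LocalRing L v)) ∧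
                  IsCompact ((Subgroup.centralizer ({g} : Set ((UnitaryGroup.cmDatum L 2 (Matrix.of fun i j : Fin 2 => if i.val + j.val + 1 = 2 then (1 : L) else 0)).Local v))) : Set ((UnitaryGroup.cmDatum L 2 (Matrix.of fun i j : Fin 2 => if i.val + j.val + 1 = 2 then (1 : L) else 0)).Local v))) →
                ∫ x, ‖B u' (ρ (x * g * x⁻¹) u)‖ ∂μ ≤ W_M (e g)))
    (hSHELL : ∀ (L : Type) [Field L] [NumberField L] [IsCMField L] {v : HeightOneSpectrum (𝓞 ↥(maximalRealSubfield L))} (w : PlacesOver L v) (hw : IsCMField.complexConj L • w.1 = w.1)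
          [MeasurableSpace ↥(unitaryGroupOfForm (galAdicCompletionMap (L := L) (IsCMField.complexConj L) hw) ((StdForm.antidiagonal 2).over (w.1.adicCompletion L)))]
          [BorelSpace ↥(unitaryGroupOfForm (galAdicCompletionMap (L := L) (IsCMField.complexConj L) hw) ((StdForm.antidiagonal 2).over (w.1.adicCompletion L)))]
          (ν : Measure ↥(unitaryGroupOfForm (galAdicCompletionMap (L := L) (IsCMField.complexConj L) hw) ((StdForm.antidiagonal 2).over (w.1.adicCompletion L)))) [ν.IsHaarMeasure]
          (Ω : CompactExhaustion ↥(unitaryGroupOfForm (galAdicCompletionMap (L := L) (IsCMField.complexConj L) hw) ((StdForm.antidiagonal 2).over (w.1.adicCompletion L)))) {ϖ : w.1.adicCompletion L}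
          (hϖ : Valued.v ϖ = WithZero.exp (-1 : ℤ))
          (hmem : ∀ (m : ℕ) (g : ↥(unitaryGroupOfForm (galAdicCompletionMap (L := L) (IsCMField.complexConj L) hw) ((StdForm.antidiagonal 2).over (w.1.adicCompletion L)))), g ∈ Ω m ↔
            (∀ i j, Valued.v (ϖ ^ m * ((g : GL (Fin 2) (w.1.adicCompletion L)) : Matrix (Fin 2) (Fin 2) (w.1.adicCompletion L)) i j) ≤ 1) ∧
              ∀ i j, Valued.v (ϖ ^ m * (((g : GL (Fin 2) (w.1.adicCompletion L))⁻¹ : GL (Fin 2) (w.1.adicCompletion L)) : Matrix (Fin 2) (Fin 2) (w.1.adicCompletion L)) i j) ≤ 1)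
          (hinv : ∀ (m : ℕ) (g : ↥(unitaryGroupOfForm (galAdicCompletionMap (L := L) (IsCMField.complexConj L) hw) ((StdForm.antidiagonal 2).over (w.1.adicCompletion L)))), g ∈ Ω m → g⁻¹ ∈ Ω m)
          (hmul : ∀ (a b : ℕ) (g h : ↥(unitaryGroupOfForm (galAdicCompletionMap (L := L) (IsCMField.complexConj L) hw) ((StdForm.antidiagonal 2).over (w.1.adicCompletion L)))), g ∈ Ω a → h ∈ Ω b → g * h ∈ Ω (a + b))
          (mθ : ℕ),
          ∃ C : ℝ≥0, ∀ (θ : ↥(unitaryGroupOfForm (galAdicCompletionMap (L := L) (IsCMField.complexConj L) hw) ((StdForm.antidiagonal 2).over (w.1.adicCompletion L))) → ℂ), Continuous θ → (∀ g, θ g ≠ 0 → g ∈ Ω mθ) →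
            ∀ (M : ℝ≥0), (∀ g, ‖θ g‖₊ ≤ M) →
            ∀ (t : ↥(torusU (galAdicCompletionMap (L := L) (IsCMField.complexConj L) hw) ((StdForm.antidiagonal 2).over (w.1.adicCompletion L)))) (d : Fin 2 → (w.1.adicCompletion L)ˣ),
              glDiagonal 2 (w.1.adicCompletion L) d = ((t : ↥(unitaryGroupOfForm (galAdicCompletionMap (L := L) (IsCMField.complexConj L) hw) ((StdForm.antidiagonal 2).over (w.1.adicCompletion L)))) : GL (Fin 2) (w.1.adicCompletion L)) →
              ∀ (g y : ↥(unitaryGroupOfForm (galAdicCompletionMap (L := L) (IsCMField.complexConj L) hw) ((StdForm.antidiagonal 2).over (w.1.adicCompletion L)))) (m : ℕ), g ∈ Ω m →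
                g = y * (t : ↥(unitaryGroupOfForm (galAdicCompletionMap (L := L) (IsCMField.complexConj L) hw) ((StdForm.antidiagonal 2).over (w.1.adicCompletion L)))) * y⁻¹ →
              ∀ (τ : ℕ), normAbs (w.1.adicCompletion L) ϖ ^ τ ≤ NNReal.sqrt (NNReal.sqrt
                  (normAbs (w.1.adicCompletion L) (((g : GL (Fin 2) (w.1.adicCompletion L)) : Matrix (Fin 2) (Fin 2) (w.1.adicCompletion L))).charpoly.discr *
                    (normAbs (w.1.adicCompletion L) (((g : GL (Fin 2) (w.1.adicCompletion L)) : Matrix (Fin 2) (Fin 2) (w.1.adicCompletion L))).det ^ 2)⁻¹)) → ∀ (R : ℕ),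
                ∫ x in Ω R, ‖θ (x * g * x⁻¹)‖ ∂ν ≤ C * M * ((2 * (R + 42 * m + 2 * mθ + 16 * τ) + 1 : ℕ) : ℝ) * ((residueFieldCard (w.1.adicCompletion L) : ℝ≥0) : ℝ) ^ m * ((NNReal.sqrt (NNReal.sqrt
                      (normAbs (w.1.adicCompletion L) (((g : GL (Fin 2) (w.1.adicCompletion L)) : Matrix (Fin 2) (Fin 2) (w.1.adicCompletion L))).charpoly.discr *
                        (normAbs (w.1.adicCompletion L) (((g : GL (Fin 2) (w.1.adicCompletion L)) : Matrix (Fin 2) (Fin 2) (w.1.adicCompletion L))).det ^ 2)⁻¹)))⁻¹ : ℝ))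
    (hTOK : ∀ (L : Type) [Field L] [NumberField L] [IsCMField L] {v : HeightOneSpectrum (𝓞 ↥(maximalRealSubfield L))} (w : PlacesOver L v) (hw : IsCMField.complexConj L • w.1 = w.1)
          [MeasurableSpace ↥(unitaryGroupOfForm (galAdicCompletionMap (L := L) (IsCMField.complexConj L) hw) ((StdForm.antidiagonal 2).over (w.1.adicCompletion L)))]
          [BorelSpace ↥(unitaryGroupOfForm (galAdicCompletionMap (L := L) (IsCMField.complexConj L) hw) ((StdForm.antidiagonal 2).over (w.1.adicCompletion L)))]
          (ν : Measure ↥(unitaryGroupOfForm (galAdicCompletionMap (L := L) (IsCMField.complexConj L) hw) ((StdForm.antidiagonal 2).over (w.1.adicCompletion L)))) [ν.IsHaarMeasure],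
          LocallyIntegrable (fun m : ↥(unitaryGroupOfForm (galAdicCompletionMap (L := L) (IsCMField.complexConj L) hw) ((StdForm.antidiagonal 2).over (w.1.adicCompletion L))) =>
            (((NNReal.sqrt (NNReal.sqrt (normAbs (w.1.adicCompletion L) (((m : GL (Fin 2) (w.1.adicCompletion L)) : Matrix (Fin 2) (Fin 2) (w.1.adicCompletion L))).charpoly.discr *
                (normAbs (w.1.adicCompletion L) (((m : GL (Fin 2) (w.1.adicCompletion L)) : Matrix (Fin 2) (Fin 2) (w.1.adicCompletion L))).det ^ 2)⁻¹)) : ℝ≥0) : ℝ))⁻¹ *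
              (1 + |Real.log (((NNReal.sqrt (NNReal.sqrt (normAbs (w.1.adicCompletion L) (((m : GL (Fin 2) (w.1.adicCompletion L)) : Matrix (Fin 2) (Fin 2) (w.1.adicCompletion L))).charpoly.discr *
                  (normAbs (w.1.adicCompletion L) (((m : GL (Fin 2) (w.1.adicCompletion L)) : Matrix (Fin 2) (Fin 2) (w.1.adicCompletion L))).det ^ 2)⁻¹)) : ℝ≥0) : ℝ))|) ^ 1) ν)
    (hTORΩ : ∀ (K : Type) [Field K] [Valued K ℤᵐ⁰] [ValuativeRel K] [(Valued.v : Valuation K ℤᵐ⁰).Compatible] [IsNonarchimedeanLocalField K] [CharZero K]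
      (σ : K →+* K), (∀ x, σ (σ x) = x) → (∀ x, Valued.v (σ x) = Valued.v x) → ∀ {ϖ : K}, Valued.v ϖ = WithZero.exp (-1 : ℤ) → ∀ {J : Matrix (Fin 2) (Fin 2) K}, J = (StdForm.antidiagonal 2).over K →
      ∀ (Ω : CompactExhaustion ↥(unitaryGroupOfForm σ J)), (∀ (m : ℕ) (g : ↥(unitaryGroupOfForm σ J)), g ∈ Ω m ↔ (∀ i j, Valued.v (ϖ ^ m * ((g : GL (Fin 2) K) : Matrix (Fin 2) (Fin 2) K) i j) ≤ 1) ∧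
          ∀ i j, Valued.v (ϖ ^ m * (((g : GL (Fin 2) K)⁻¹ : GL (Fin 2) K) : Matrix (Fin 2) (Fin 2) K) i j) ≤ 1) →
      ∀ {t y : ↥(unitaryGroupOfForm σ J)} {d : Fin 2 → Kˣ}, glDiagonal 2 K d = (t : GL (Fin 2) K) →
        ∀ {m : ℕ}, y * t * y⁻¹ ∈ Ω m → ∀ i : Fin 2, Valued.v (ϖ ^ m * (d i : K)) ≤ 1 ∧ Valued.v (ϖ ^ m * ((d i : K))⁻¹) ≤ 1)
    (hDEPTH : ∀ (K : Type) [Field K] [Valued K ℤᵐ⁰] [ValuativeRel K] [(Valued.v : Valuation K ℤᵐ⁰).Compatible] [IsNonarchimedeanLocalField K] [CharZero K]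
      {ϖ : K}, Valued.v ϖ = WithZero.exp (-1 : ℤ) → ∀ {d : Fin 2 → Kˣ} {m : ℕ}, (∀ i, Valued.v (ϖ ^ m * (d i : K)) ≤ 1) → (∀ i, Valued.v (ϖ ^ m * ((d i : K))⁻¹) ≤ 1) → ∀ {τ : ℕ},
      normAbs K ϖ ^ τ ≤ NNReal.sqrt (NNReal.sqrt (normAbs K ((((glDiagonal 2 K d : GL (Fin 2) K) : Matrix (Fin 2) (Fin 2) K)).charpoly.discr) *
          (normAbs K ((((glDiagonal 2 K d : GL (Fin 2) K) : Matrix (Fin 2) (Fin 2) K)).det) ^ 2)⁻¹)) → ∀ {i k : Fin 2}, i ≠ k → Valued.v (ϖ ^ (4 * τ + 10 * m)) ≤ Valued.v ((d i : K) - d k)) :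
    (∀ (L' : Type) [Field L'] [NumberField L'] [IsCMField L'] {v' : HeightOneSpectrum (𝓞 ↥(maximalRealSubfield L'))}
      (w' : UnitaryGroup.PlacesOver L' v') (hw' : IsCMField.complexConj L' • w'.1 = w'.1)
      [MeasurableSpace ↥(unitaryGroupOfForm (galAdicCompletionMap (L := L') (IsCMField.complexConj L') hw') ((StdForm.antidiagonal 2).over (w'.1.adicCompletion L')))]
      [BorelSpace ↥(unitaryGroupOfForm (galAdicCompletionMap (L := L') (IsCMField.complexConj L') hw') ((StdForm.antidiagonal 2).over (w'.1.adicCompletion L')))]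
      (μ' : Measure ↥(unitaryGroupOfForm (galAdicCompletionMap (L := L') (IsCMField.complexConj L') hw') ((StdForm.antidiagonal 2).over (w'.1.adicCompletion L')))) [μ'.IsHaarMeasure]
      {S : Set ↥(unitaryGroupOfForm (galAdicCompletionMap (L := L') (IsCMField.complexConj L') hw') ((StdForm.antidiagonal 2).over (w'.1.adicCompletion L')))} (_ : IsCompact S),
      ∃ W_E : ↥(unitaryGroupOfForm (galAdicCompletionMap (L := L') (IsCMField.complexConj L') hw') ((StdForm.antidiagonal 2).over (w'.1.adicCompletion L'))) → ℝ,
        LocallyIntegrable W_E μ' ∧ (∀ g, 0 ≤ W_E g) ∧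
        ∀ γ : ↥(unitaryGroupOfForm (galAdicCompletionMap (L := L') (IsCMField.complexConj L') hw') ((StdForm.antidiagonal 2).over (w'.1.adicCompletion L'))),
          IsRegularElt (γ : GL (Fin 2) (w'.1.adicCompletion L')) →
          IsCompact ((Subgroup.centralizer ({γ} : Set ↥(unitaryGroupOfForm (galAdicCompletionMap (L := L') (IsCMField.complexConj L') hw') ((StdForm.antidiagonal 2).over (w'.1.adicCompletion L'))))) :
              Set ↥(unitaryGroupOfForm (galAdicCompletionMap (L := L') (IsCMField.complexConj L') hw') ((StdForm.antidiagonal 2).over (w'.1.adicCompletion L')))) →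
            ∀ Θ : ↥(unitaryGroupOfForm (galAdicCompletionMap (L := L') (IsCMField.complexConj L') hw') ((StdForm.antidiagonal 2).over (w'.1.adicCompletion L'))) → ℝ≥0∞,
              Measurable Θ → (∀ g, Θ g ≠ 0 → g ∈ S) → ∀ Mb : ℝ≥0∞, (∀ g, Θ g ≤ Mb) → ∫⁻ x, Θ (x * γ * x⁻¹) ∂μ' ≤ ENNReal.ofReal (W_E γ) * Mb) →
    ∀ (L : Type) [Field L] [NumberField L] [IsCMField L] (v : HeightOneSpectrum (𝓞 ↥(maximalRealSubfield L))), (∀ w : PlacesOver L v, IsCMField.complexConj L • w.1 = w.1) →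
    ∀ [MeasurableSpace ((UnitaryGroup.cmDatum L 2 (Matrix.of fun i j : Fin 2 => if i.val + j.val + 1 = 2 then (1 : L) else 0)).Local v)] [BorelSpace ((UnitaryGroup.cmDatum L 2 (Matrix.of fun i j : Fin 2 => if i.val + j.val + 1 = 2 then (1 : L) else 0)).Local v)]
      (μ : Measure ((UnitaryGroup.cmDatum L 2 (Matrix.of fun i j : Fin 2 => if i.val + j.val + 1 = 2 then (1 : L) else 0)).Local v)) [μ.IsHaarMeasure]
      (r : SmoothIrrep ((UnitaryGroup.cmDatum L 2 (Matrix.of fun i j : Fin 2 => if i.val + j.val + 1 = 2 then (1 : L) else 0)).Local v)), r.ρ.IsSupercuspidal →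
    ∀ (B : r.V →ₗ⋆[ℂ] r.V →ₗ[ℂ] ℂ), B.IsSymm → (∀ x : r.V, x ≠ 0 → 0 < (B x x).re) →
      (∀ (g : ((UnitaryGroup.cmDatum L 2 (Matrix.of fun i j : Fin 2 => if i.val + j.val + 1 = 2 then (1 : L) else 0)).Local v)) (x y : r.V), B (r.ρ g x) (r.ρ g y) = B x y) → ∀ (v₁ : r.V), v₁ ≠ 0 →
      ∃ (Ω : CompactExhaustion ((UnitaryGroup.cmDatum L 2 (Matrix.of fun i j : Fin 2 => if i.val + j.val + 1 = 2 then (1 : L) else 0)).Local v))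
        (F : ((UnitaryGroup.cmDatum L 2 (Matrix.of fun i j : Fin 2 => if i.val + j.val + 1 = 2 then (1 : L) else 0)).Local v) → ℂ) (M : ((UnitaryGroup.cmDatum L 2 (Matrix.of fun i j : Fin 2 => if i.val + j.val + 1 = 2 then (1 : L) else 0)).Local v) → ℝ),
        (∀ᵐ g ∂μ, ¬ (IsRegularElt (g.val : GL (Fin 2) (UnitaryGroup.LocalRing L v)) ∧
            IsCompact ((Subgroup.centralizer ({g} : Set ((UnitaryGroup.cmDatum L 2 (Matrix.of fun i j : Fin 2 => if i.val + j.val + 1 = 2 then (1 : L) else 0)).Local v))) : Set ((UnitaryGroup.cmDatum L 2 (Matrix.of fun i j : Fin 2 => if i.val + j.val + 1 = 2 then (1 : L) else 0)).Local v))) →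
          Tendsto (fun n => ∫ x in Ω n, B v₁ (r.ρ (x * g * x⁻¹) v₁) ∂μ) atTop (𝓝 (F g))) ∧ (∀ n : ℕ, ∀ᵐ g ∂μ, ‖∫ x in Ω n, B v₁ (r.ρ (x * g * x⁻¹) v₁) ∂μ‖ ≤ M g) ∧ LocallyIntegrable M μ := by
  intro hEW L _ _ _ v hns _ _ μ _ r hsc B _ _ hBinv v₁ _
  obtain ⟨w⟩ := (inferInstance : Nonempty (PlacesOver L v))
  have hw : IsCMField.complexConj L • w.1 = w.1 := hns w
  have hΦ : placeForm (Matrix.of fun i j : Fin 2 => if i.val + j.val + 1 = 2 then (1 : L) else 0) w.1 = (StdForm.antidiagonal 2).over (w.1.adicCompletion L) := by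
    rw [UnitaryGroup.antidiagOne_eq_over L 2]
    exact StdForm.over_map _ _
  have ψ := localNonsplitEquiv (IsCMField.complexConj L) (Matrix.of fun i j : Fin 2 => if i.val + j.val + 1 = 2 then (1 : L) else 0) (IsCMField.complexConj_ne_one L) w hw
  rw [hΦ] at ψ
  exact K2E3SupercuspidalTruncatedCharAnalyticOfEllWeightPlaceTwo.sigSCan_datum_of_ellWeightPlace_of_fieldModel_two hLIM hSHELL hTOK hTORΩ hDEPTH hEW L v hns w hw μ ψ r hsc B hBinv v₁

end Summit.HodgeConjecture.HodgeConjecture.Cruxes.H413.K2E3SupercuspidalTruncatedCharAnalyticTwoOfEllWeight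

end
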